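/-
Origin: expansion seat `literature-prover-pub-hodgecm-cf-kudla-howe-rallis-g4-0`, handover #5 v3 2026-08-18T07:44:28Z (`HOME/pub-hodgecm-cf-kudla-howe-rallis-g4/N31aFromLiterature.lean`, md5 ffa05bd3, 177 lines);
landed by the gen-7 packager in gate run 26 as `HodgeCM/PerL34/N31aFromLiterature.lean` (verbatim).
-/
/-
Origin: HOME/pub-hodgecm-cf-kudla-howe-rallis-g4/N31aFromLiterature.lean — session
literature-prover-pub-hodgecm-cf-kudla-howe-rallis-g4-0 (unit pub-hodgecm-cf-kudla-howe-rallis-g4, CITED-FACT seat (4), gen 4).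
Intended final place: `HodgeCM/PerL34/N31aFromLiterature.lean` (NEW leaf; imports the LANDED `HodgeCM.PerL34.CharsB_local`
(pv12, node N31a) and `HodgeCM.Literature.ThetaCorrespondence` (cf-KHR); nothing imports it).
-/
import Summits.HodgeConjecture.HodgeCM.PerL34.CharsB_local
import Summits.HodgeConjecture.HodgeCM.Literature.ThetaCorrespondence_4

set_option autoImplicit false

/-!
# Node N31a's Sun–Zhu / persistence / stable-range inputs, consumed BY NAME from the theta Literature layer

pv12's `HodgeCM.PerL34.N31a.NonsplitPlaceThetaData` (run 20) carries the three PRINT inputs of PerL v5 Lemma 4.2(b),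
ll. 544–547, at a finite place of `L₀` non-split in `L` as its own labelled fields `Conservation` ([SZ15 Thm 1.10]),
`Persistence` ([SZ15 §1.5], Kudla) and `FiniteFirstOcc` ([SZ15 §1.5], stable range), each quoted verbatim there.  The
SAME three printed statements are typed, verbatim with journal pages, in `HodgeCM/Literature/ThetaCorrespondence.lean`:
`WittTowerDatum.ConservationRelation` (KHR-3, [SZ15, Thm 1.10, JAMS 28 p. 945]), `TowerOccurrenceDatum.KudlaPersistence`
and `TowerOccurrenceDatum.StableRangeOccurrence` (KHR-4, [SZ15, §1.5 p. 944, (7) and the second bullet]) — until now with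
no by-name consumer (lineage census of by-name consumers, gen 4).  This file gives the DICTIONARY-FREE identifications:

* `toWittTowerDatum D` — N31a's data read as a `WittTowerDatum` (`U = W_{i,v}` a line: `dim U = 1`; `D = L_w`
  quadratic: `d_{D,ε} = 2`, [SZ15 Prop 1.6 p. 942]; the two odd towers `t_{true}`, `t_{false}`; every character of the
  compact `U(W_{i,v})` is genuine for PerL's fixed splitting, so `genuine := True`); `conservation_iff` :
  `ConservationRelation (toWittTowerDatum D) ↔ D.Conservation` (definitional: `2·1 + 2 = 4`).
* `toTowerDatum D ε` — the tower `t_ε` as a `TowerOccurrenceDatum` (members indexed by `r`, `dim = 2r+1`, Witt index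
  `rank = r`); `persistence_iff` : `(∀ ε, KudlaPersistence (toTowerDatum D ε)) ↔ D.Persistence`;
  `finiteFirstOcc_of_stableRange`, `occurs_V3_of_stableRange` : Li's stable-range occurrence (KHR-4, [Li89] as quoted by
  [SZ15 (7)]) gives N31a's conclusion `D.Occurs D.signV3 1 χ` DIRECTLY (rank 1 ≥ dim U = 1) — the ALTERNATIVE route
  recorded in KHR-4's docstring, now a kernel arrow — and also `FiniteFirstOcc`.
* `occurs_V3_of_literature` : pv12's `occurs_V3` fed from the Literature records through the `iff`s (PerL's own route:
  conservation + persistence + finiteness).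
* Split places (§2): pv12's PRINT field `LocalOccurrenceData.MinguezTypeII` ([Mín08 Thm 1(2)]: every character of
  `GL₁(L_{0,v})` occurs for `(GL₁, GL₃)`) fed BY NAME from KHR-14 `TypeIIDatum.TypeIIOccurrence` ([MVW, Chap. 3
  §III.4–5, p. 64], the v4 record with referee 2's ADVISORY-A3 guard `1 ≤ m₀'`) through its kernel consequence
  `everyCharacterOccurs` (`m = 1 ≤ m' = 3`) and ONE labelled D4 reading `SplitTypeIIReading` (pv12's uninterpreted
  `OccursSplit v χ` = "`Hom_{GL₁}(ω_{1,3}, χ) ≠ 0`" [Mín08 (1.4)] IS MVW's "`χ ⊗ ν^{3/2}` quotient de `σ_{1,3}`" —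
  the character twist relating `ω_{1,3}` to `σ_{1,3}`, see the record's docstring) — `minguezTypeII_of_typeII`; and the
  whole node: `N31a_of_literature` (pv12's `N31a_of_published` with all four published inputs fed by name from
  `HodgeCM/Literature/ThetaCorrespondence.lean`) and `N31a_of_stableRange` (N27 + Li's stable range + MVW only).

Nothing is cited anew here; no `def … : Prop`; the only non-kernel ingredient is the labelled D4 reading
`SplitTypeIIReading` (LEMMAS.md §3 D4: local Weil representations are a posited interface); classes unchanged (the
inputs stay PRINT, now BY NAME).
-/

namespace HodgeCM.PerL34.N31a.N31aFromLiterature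

open HodgeCM.Literature.Theta NonsplitPlaceThetaData

variable (D : NonsplitPlaceThetaData)

/-- N31a's two-tower data as a `WittTowerDatum` ([SZ15 Thm 1.10] carriers): `n₁ = n_{t_true}`, `n₂ = n_{t_false}`,
`dim U = 1`, `d_{D,ε} = 2`. -/
noncomputable def toWittTowerDatum : WittTowerDatum.{0} where
  IrrG := D.X
  genuine := fun _ => True
  n₁ := fun χ => D.firstOcc true χ
  n₂ := fun χ => D.firstOcc false χ
  dimU := 1
  d := 2

/-- **KHR-3 ↔ pv12's `Conservation`** (definitional). -/
theorem conservation_iff : (toWittTowerDatum D).ConservationRelation ↔ D.Conservation := by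
  constructor
  · intro h χ
    exact h χ trivial
  · intro h χ _
    exact h χ

/-- The tower `t_ε` as a `TowerOccurrenceDatum` ([SZ15 §1.5] carriers): members `r : ℕ` of dimension `2r+1` and Witt
index `r`. -/
def toTowerDatum (ε : Bool) : TowerOccurrenceDatum.{0} where
  IrrG := D.X
  Sp := ℕ
  dim := fun r => 2 * r + 1
  rank := fun r => r
  occurs := fun χ r => D.Occurs ε r χ
  genuine := fun _ => True
  dimU := 1

/-- **KHR-4 (persistence), tower by tower** (definitional: within an odd tower `dim σ₁ ≤ dim σ₂ ↔ r₁ ≤ r₂`). -/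
theorem kudlaPersistence_iff (ε : Bool) :
    (toTowerDatum D ε).KudlaPersistence ↔
      ∀ (χ : D.X) (r₁ r₂ : ℕ), r₁ ≤ r₂ → D.Occurs ε r₁ χ → D.Occurs ε r₂ χ := by
  show (∀ (χ : D.X) (r₁ r₂ : ℕ), True → 2 * r₁ + 1 ≤ 2 * r₂ + 1 → D.Occurs ε r₁ χ → D.Occurs ε r₂ χ) ↔ _
  constructor
  · intro h χ r₁ r₂ hr hocc
    exact h χ r₁ r₂ trivial (by omega) hocc
  · intro h χ r₁ r₂ _ hdim hocc
    exact h χ r₁ r₂ (by omega) hocc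

/-- **KHR-4 (persistence) ↔ pv12's `Persistence`.** -/
theorem persistence_iff : (∀ ε, (toTowerDatum D ε).KudlaPersistence) ↔ D.Persistence := by
  unfold NonsplitPlaceThetaData.Persistence
  exact forall_congr' fun ε => kudlaPersistence_iff D ε

/-- **KHR-4 (Li's stable range), tower by tower** (definitional: `rank σ ≥ dim U ↔ 1 ≤ r`). -/
theorem stableRangeOccurrence_iff (ε : Bool) :
    (toTowerDatum D ε).StableRangeOccurrence ↔ ∀ (χ : D.X) (r : ℕ), 1 ≤ r → D.Occurs ε r χ := by
  show (∀ (χ : D.X) (r : ℕ), True → 1 ≤ r → D.Occurs ε r χ) ↔ _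
  exact ⟨fun h χ r hr => h χ r trivial hr, fun h χ r _ hr => h χ r hr⟩

variable {D}

/-- **Li's stable range (KHR-4) gives N31a's conclusion directly:** the member of dimension 3 has Witt index
`1 ≥ dim U = 1`, so EVERY character occurs there — in either tower, in particular for `V_{3,v}`. -/
theorem occurs_dim_three_of_stableRange (h : ∀ ε, (toTowerDatum D ε).StableRangeOccurrence) (ε : Bool) (χ : D.X) :
    D.Occurs ε 1 χ :=
  (stableRangeOccurrence_iff D ε).mp (h ε) χ 1 le_rfl

/-- (Ported verbatim from the HodgeCMPerL package; no docstring in the source.) -/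
theorem occurs_V3_of_stableRange (h : ∀ ε, (toTowerDatum D ε).StableRangeOccurrence) (χ : D.X) :
    D.Occurs D.signV3 1 χ :=
  occurs_dim_three_of_stableRange h D.signV3 χ

/-- … and the finiteness of the first occurrence index ([SZ15 §1.5 "the first occurrence index is finite"]). -/
theorem finiteFirstOcc_of_stableRange (h : ∀ ε, (toTowerDatum D ε).StableRangeOccurrence) : D.FiniteFirstOcc :=
  fun ε χ => ⟨1, occurs_dim_three_of_stableRange h ε χ⟩

/-- **PerL's own route (conservation + persistence + finiteness), every input BY NAME from the Literature records:**
pv12's `occurs_V3` fed through the two `iff`s and the stable-range finiteness. -/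
theorem occurs_V3_of_literature (hcons : (toWittTowerDatum D).ConservationRelation)
    (hper : ∀ ε, (toTowerDatum D ε).KudlaPersistence) (hsr : ∀ ε, (toTowerDatum D ε).StableRangeOccurrence)
    (χ : D.X) : D.Occurs D.signV3 1 χ :=
  occurs_V3 (finiteFirstOcc_of_stableRange hsr) ((persistence_iff D).mp hper) ((conservation_iff D).mp hcons) χ

/-! ## 2. Split places: MVW type II occurrence (KHR-14) ⇒ pv12's `MinguezTypeII`; the whole node -/

/-- **D4 reading at a split place (labelled dictionary record; LEMMAS.md §3 D4).**  A type II carrier `T` for the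
pairs `(GL_m(L_{0,v}), GL_{m'}(L_{0,v}))` ([MVW, Chap. 3 §III.1]: `σ_{m,m'}` on `S(M(m,m';D), ℂ)`, `D = L_{0,v}`),
the reading `asIrr` of pv12's characters `Xsplit v` of `GL₁(L_{0,v})` as elements of `Irr H₁`, TWISTED by the
character relating the Weil representation `ω_{1,3}` to `σ_{1,3}`: in pv12's normalisation [Mín08 (1.4), Ann. Sci.
ÉNS 41 (2008), p. 721]: "`ω_{n,m}(g, g') = ν(g)^{-m/2} σ_{n,m}(g, g') ν(g')^{n/2}`", so `Hom_{G₁}(ω_{1,3}, χ) =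
Hom_{G₁}(σ_{1,3}, χ ⊗ ν^{3/2})` and `asIrr χ = χ ⊗ ν^{3/2}` (`ν = |Nrd|_F`, [Mín08 p. 722]; here `D = F`, `ν = |dét|`); [MVW, Chap. 3 §III.1, p0071 L6] normalises
with the opposite sign on the first factor: "A un caractère près, c'est la représentation métaplectique … `M = σ ⊗
ν_m^{m'/2} ⊗ ν_{m'}^{m/2}`" (Mínguez's footnote (1), p. 721: "Dans [14, 3.III.1], on utilise une définition
légèrement différente") — under either sign the twist is a bijection on characters, so "every character occurs" is
normalisation-free; and the identification of pv12's uninterpreted predicate `OccursSplit v χ` ("`Hom_{GL₁}(ω_{1,3},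
χ) ≠ 0`", [Mín08 (1.4)], CharsB_local) with MVW's "`asIrr χ` est quotient de `σ_{1,3}`".  No print claim beyond the
quoted sentences; this is the instantiation, recorded as data. -/
structure SplitTypeIIReading (L : LocalOccurrenceData) (v : L.SplitPlace) where
  /-- the MVW carrier at `v` -/
  T : TypeIIDatum.{0}
  /-- `χ ↦ χ ⊗ ν^{3/2} ∈ Irr GL₁(L_{0,v})` (pv12's / Mínguez's normalisation of `ω_{1,3}`) -/
  asIrr : L.Xsplit v → T.Irr 1
  /-- `Hom_{GL₁}(ω_{1,3}, χ) ≠ 0 ↔ asIrr χ` is a quotient of `σ_{1,3}` -/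
  occurs_iff : ∀ χ : L.Xsplit v, L.OccursSplit v χ ↔ T.quot 1 3 (asIrr χ)

/-- **KHR-14 ⇒ pv12's `MinguezTypeII`, by name:** MVW's Lemme III.4 + III.5 + Cor. III.3 a) (typed, v4) give
"every character of `GL₁` is a quotient of `σ_{1,3}`" (`TypeIIOccurrence.everyCharacterOccurs`, `1 ≤ 3`), read back
through the D4 reading. -/
theorem minguezTypeII_of_typeII {L : LocalOccurrenceData} (R : ∀ v, SplitTypeIIReading L v)
    (hII : ∀ v, (R v).T.TypeIIOccurrence) : L.MinguezTypeII :=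
  fun v χ => ((R v).occurs_iff χ).mpr ((hII v).everyCharacterOccurs ((R v).asIrr χ) (by norm_num))

/-- **Node N31a with EVERY published input fed by name from the cited-fact file** (pv12's `N31a_of_published`:
`N27 → [SZ §1.5 finiteness] → [SZ §1.5 persistence] → [SZ Thm 1.10] → [Mín Thm 1(2)] → N31a_statement`), the four
bracketed inputs now being KHR-4 (stable range ⇒ finiteness), KHR-4 (persistence), KHR-3, KHR-14. -/
theorem N31a_of_literature {L : LocalOccurrenceData} (hN27 : L.RealClausesN27)
    (hcons : ∀ v, (toWittTowerDatum (L.nonsplit v)).ConservationRelation)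
    (hper : ∀ v ε, (toTowerDatum (L.nonsplit v) ε).KudlaPersistence)
    (hsr : ∀ v ε, (toTowerDatum (L.nonsplit v) ε).StableRangeOccurrence)
    (R : ∀ v, SplitTypeIIReading L v) (hII : ∀ v, (R v).T.TypeIIOccurrence) : L.N31a_statement :=
  L.N31a_of_published hN27 (fun v => finiteFirstOcc_of_stableRange (hsr v))
    (fun v => (persistence_iff (L.nonsplit v)).mp (hper v))
    (fun v => (conservation_iff (L.nonsplit v)).mp (hcons v)) (minguezTypeII_of_typeII R hII)

/-- **The short route:** N27 + Li's stable range (KHR-4) + MVW (KHR-14) already give `N31a_statement` — no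
conservation relation, no persistence, no parity bookkeeping (the ALTERNATIVE of CITED-FACTS KHR-4 / GAPS cfKHR-C3,
as a kernel arrow). -/
theorem N31a_of_stableRange {L : LocalOccurrenceData} (hN27 : L.RealClausesN27)
    (hsr : ∀ v ε, (toTowerDatum (L.nonsplit v) ε).StableRangeOccurrence)
    (R : ∀ v, SplitTypeIIReading L v) (hII : ∀ v, (R v).T.TypeIIOccurrence) : L.N31a_statement :=
  ⟨hN27, fun v ε χ => occurs_dim_three_of_stableRange (hsr v) ε χ, minguezTypeII_of_typeII R hII⟩

end HodgeCM.PerL34.N31a.N31aFromLiterature
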